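import Summits.BirchSwinnertonDyer.BirchSwinnertonDyer.Theorems.ByReductionTypeAtTwoSupersingularFlatBlindPinchOfAvatar
import Summits.BirchSwinnertonDyer.Rank1Residual.Supersingular.PlusSymbolParityTwo
import HarnessLib

/-!
# R-imc-90c v2 — THE EVEN-HALF LAW IS A TREE THEOREM (o1 cell, 2026-08-21/22): credits by name, and the two
# corollaries in the currency of crux `SupersingularRankZeroAtTwo` (stmt-BirchSwinnertonDyer-19097) PROVED from it
(cell `bsd-f1-sign2`, seat `-imc` g36, LENS Iwasawa-main-conjecture «where the 2-adic error terms sit»; registered line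
`odd_blind_package` v2.17 b90024f4; this file SUPERSEDES v1 4a6a4aa2184426dc of the same path)

CORRECTION OF v1 (search-the-tree failure of this seat, owned).  v1 stated an «even-half law» — (A) good supersingular at `2` ⟹
`Δ_min ≡ 5 (mod 8)` and `N ≡ ±1 (mod 8) ⟹ 2 ∣ ∏c_p`; (B) rank `0`, `N ≡ ±1 (mod 8) ⟹ 2 ∣ L(E,1)/Ω` — as prose theorem + typed
`@[conjecture]` targets, asking for placement.  BOTH HALVES ARE ALREADY THEOREMS OF THE TREE, landed by the `b2b-bsdres` O1 `p = 2`
sub-cell (lens-1 GEN 9–11, o1 refuter GEN 19, cc-typer-4 GEN 6–11), with the same Cremona censuses (50552 = 18179 + 32373; 226175):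
* (A) = `Summit.BirchSwinnertonDyer.Rank1Residual.Supersingular.conductorNorm_emod_eight_eq_three_or_eq_five_of_goodSS_two`,
  `χ₈_conductorNorm_eq_neg_one_of_goodSS_two`, `minimalDiscriminantInt_emod_eight_eq_five_of_goodSS_two` (`TamParityChi8Link.lean`),
  over `TamParityChi8.Δ_emod_eight` / `emod_eight_of_mul_abs_eq_sq` and `TamagawaParitySquare.exists_conductorNorm_mul_abs_minimalDiscriminantInt_eq_sq`
  (`Tam(E)` odd ⟹ `N·|Δ_min|` a square, via `odd_numComponentsAt_of_odd_localTamagawaNumber` + Ogg–Saito) — v1's integer hinges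
  `Δ_emod_eight_of_even_a₁_of_odd_a₃` / `emod_eight_of_mul_eq_sq` were independent re-proofs of the first two and are withdrawn
  (one-writer rule);
* (B) = T-PAR2 `one_le_padicValRat_ratPlusSymbol_zero_of_sign` / `norm_ratPlusSymbol_zero_lt_one_of_sign` (`PlusSymbolParityTwo.lean`:
  `2 ∣ L♭(−2)` under `w(E)·χ₈(N) = +1` (`two_dvd_evalAt_flat_neg_two`, the blind `♭`-law) + the coupling `g(0) ≡ g(−2) (mod 2)` +
  `L♭(0) = (−a₂²+2a₂+1)·[0]⁺_f`), unconditional given the newform `hf`; and the two-sided reading «both BSD₂ shadows hold on the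
  habitat» = `bsd_two_parity_coherence_of_sign`, `two_dvd_tamagawaProduct_of_sign`.
So v1's (A)/(B) carry NO novelty: IN-TREE [folklore].  What remains this seat's own in R-imc-90c: the D-imc-90 DATA on the named
residual R-imc-76 (L-value-bit pinch certifiable on 91/117 classes, the 26 others Tamagawa-blocked with `#Ш_an = 1`) and the
consequence for stub 5/5 of the line — the first binary digit of BSD₂ on the habitat is sign-forced on both sides BY TREE THEOREMS,
so the 2-adic error terms of the line start at the SECOND digit, where the pinch `v₂(L(E,1)/Ω_E) = 1` lives.

WHAT THIS FILE PROVES (composition of the tree theorems above, a few lines each; no `sorry`, no new axiom, no definition):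
* `two_dvd_tamagawaProduct_of_goodSS_two_of_conductorNorm_emod_eight` — `GoodSS W 2 → N_W ≡ ±1 (mod 8) → 2 ∣ Tam(W)` (rank- and
  sign-free form of (A): the contrapositive of `conductorNorm_emod_eight_eq_three_or_eq_five_of_goodSS_two`); `evenHalfTamagawaParityAtTwo`
  = v1's typed target `EvenHalfTamagawaParityAtTwo`, now a theorem (the `@[conjecture]` node is retired);
* `rootNumber_mul_χ₈_eq_one_of_lvalue_ne_zero` — `L(W,1) ≠ 0 → N_W ≡ ±1 (mod 8) → w(W)·χ₈(N_W) = 1` (the o1 sign binder `hsign` on the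
  rank-`0` even half);
* `evenHalf_one_le_padicValRat_lvalue` — v1's typed target `EvenHalfLValueParityAtTwo` in the registry kernel's `Ω_E`-currency
  (`t = L(W,1)/realPeriodRat`, period ratio `ϖ·Ω_E = Ω⁺_f` as in `FlatBlindPinch.bsdp_two_of_flatBlindPinch_of_avatar`), PROVED from
  T-PAR2 under the one explicit extra input `0 ≤ v₂(ϖ)` (2-integrality of the period ratio = the o1 (P′)/Abbes–Ullmo input,
  `BlindInterpolationFlatTwoUnit.interpolationUnit_flat_two_of_abbesUllmo`); without a period hypothesis the `Ω_E`-statement is not a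
  consequence of T-PAR2, so v1's second `@[conjecture]` node is retired in favour of this hypothesis-explicit theorem.
Nothing here closes a registered stub; 19097 OPEN on 5 stubs; beyond-print theorem: no; BSD proved for no curve.
-/

open scoped Classical MatrixGroups ModularForm NumberField
open NumberField CongruenceSubgroup WeierstrassCurve PowerSeries
open Literature.NumberTheory.EllipticCurves Literature.NumberTheory.EllipticCurves.ModularForms
  Literature.NumberTheory.EllipticCurves.Rank1Residual Literature.NumberTheory.EllipticCurves.Rank1Residual.Typed
open Summit.BirchSwinnertonDyer.Rank1Residual Summit.BirchSwinnertonDyer.Rank1Residual.Supersingular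

set_option linter.dupNamespace false
set_option autoImplicit false

namespace Summit.BirchSwinnertonDyer.BirchSwinnertonDyer.Cruxes.SupersingularRankZeroAtTwo.R90c

/-! ## §1 The Tamagawa half in the crux's currency (`N ≡ ±1 (mod 8)`, no sign, no rank) -/

/-- `χ₈(n) = 1` for `n ≡ ±1 (mod 8)`. [folklore] -/
theorem χ₈_natCast_eq_one_of_mod_eight {n : ℕ} (hn : n % 8 = 1 ∨ n % 8 = 7) : ZMod.χ₈ (n : ZMod 8) = 1 := by
  rw [ZMod.χ₈_nat_eq_if_mod_eight]
  have h2 : n % 2 ≠ 0 := by omega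
  rw [if_neg h2, if_pos hn]

/-- **(A) in the crux's currency.** `GoodSS W 2 → N_W ≡ ±1 (mod 8) → 2 ∣ Tam(W)` — the contrapositive of the TREE theorem
`conductorNorm_emod_eight_eq_three_or_eq_five_of_goodSS_two` (o1 lens-1 GEN 9 / cc-typer-4 GEN 6, `TamParityChi8Link.lean`).
[folklore] -/
theorem two_dvd_tamagawaProduct_of_goodSS_two_of_conductorNorm_emod_eight (W : WeierstrassCurve ℚ) [W.IsElliptic]
    [W.IsGloballyMinimal] (h : GoodSS W 2) (hN : (W.conductorNorm ℤ) % 8 = 1 ∨ (W.conductorNorm ℤ) % 8 = 7) :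
    2 ∣ W.tamagawaProduct := by
  by_contra hodd
  have hodd' : Odd W.tamagawaProduct := Nat.odd_iff.mpr (Nat.two_dvd_ne_zero.mp hodd)
  have h35 := conductorNorm_emod_eight_eq_three_or_eq_five_of_goodSS_two W h hodd'
  omega

/-- v1's typed target `EvenHalfTamagawaParityAtTwo`, verbatim, now a THEOREM (its `@[conjecture]` node is retired). [folklore] -/
theorem evenHalfTamagawaParityAtTwo :
    ∀ (W : WeierstrassCurve ℚ) [W.IsElliptic] [W.IsGloballyMinimal], GoodSS W 2 →
      ((W.conductorNorm ℤ) % 8 = 1 ∨ (W.conductorNorm ℤ) % 8 = 7) → 2 ∣ W.tamagawaProduct :=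
  fun W _ _ h hN => two_dvd_tamagawaProduct_of_goodSS_two_of_conductorNorm_emod_eight W h hN

/-! ## §2 The L-value half in the crux's currency (rank `0`, `Ω_E = realPeriodRat`, period ratio explicit) -/

/-- The o1 sign binder on the rank-`0` even half: `L(W,1) ≠ 0 ⟹ w(W) = +1` (`rootNumber_eq_one_or`,
`entireLFunction_one_eq_zero_of_rootNumber_eq_neg_one`) and `N_W ≡ ±1 (mod 8) ⟹ χ₈(N_W) = 1`. [folklore] -/
theorem rootNumber_mul_χ₈_eq_one_of_lvalue_ne_zero (W : WeierstrassCurve ℚ) [W.IsElliptic]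
    (hL : W.entireLFunction 1 ≠ 0) (hN : (W.conductorNorm ℤ) % 8 = 1 ∨ (W.conductorNorm ℤ) % 8 = 7) :
    W.rootNumber * ZMod.χ₈ (W.conductorNorm ℤ : ZMod 8) = 1 := by
  have hw : W.rootNumber = 1 := by
    rcases W.rootNumber_eq_one_or with h | h
    · exact h
    · exact absurd (WeierstrassCurve.entireLFunction_one_eq_zero_of_rootNumber_eq_neg_one h) hL
  rw [hw, one_mul]
  exact χ₈_natCast_eq_one_of_mod_eight hN

/-- **(B) in the crux's currency.** For `W` good supersingular at `2` with `N_W ≡ ±1 (mod 8)` and `L(W,1) ≠ 0`, `f` its newform and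
`ϖ ∈ ℚ` the period ratio `ϖ·Ω_E = Ω⁺_f` of the registry kernel (`FlatBlindPinch.bsdp_two_of_flatBlindPinch_of_avatar`), 2-INTEGRAL
(`0 ≤ v₂(ϖ)`, the o1 (P′)/Abbes–Ullmo input): the canonical rational `t = L(W,1)/Ω_E` has `1 ≤ v₂(t)`.  Composition: `t = ϖ·[0]⁺_f`
(`IsNewformOf.entireLFunction_one_eq`) and T-PAR2 `one_le_padicValRat_ratPlusSymbol_zero_of_sign` (o1 refuter GEN 19 /
cc-typer-4 GEN 11, `PlusSymbolParityTwo.lean`). [folklore] -/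
theorem evenHalf_one_le_padicValRat_lvalue (W : WeierstrassCurve ℚ) [W.IsElliptic] [W.IsGloballyMinimal]
    (h : GoodSS W 2) (hN : (W.conductorNorm ℤ) % 8 = 1 ∨ (W.conductorNorm ℤ) % 8 = 7) (hL : W.entireLFunction 1 ≠ 0)
    [NeZero (W.conductorNorm ℤ)] {f : CuspForm (Gamma0 (W.conductorNorm ℤ)) 2} (hf : IsNewformOf W f)
    {ϖ : ℚ} (hϖ : (ϖ : ℝ) * W.realPeriodRat = plusPeriod f) (hϖ2 : 0 ≤ padicValRat 2 ϖ)
    {t : ℚ} (ht : W.entireLFunction 1 / (W.realPeriodRat : ℂ) = ((t : ℚ) : ℂ)) :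
    1 ≤ padicValRat 2 t := by
  have hsign := rootNumber_mul_χ₈_eq_one_of_lvalue_ne_zero W hL hN
  have hs : 1 ≤ padicValRat 2 (ratPlusSymbol f 0) :=
    one_le_padicValRat_ratPlusSymbol_zero_of_sign hf h.1 h.2 hsign hL
  have hΩpos : 0 < W.realPeriodRat := W.realPeriodRat_pos_holds
  have ht' : W.entireLFunction 1 / (W.realPeriodRat : ℂ) = (((ϖ * ratPlusSymbol f 0 : ℚ)) : ℂ) := by
    rw [hf.entireLFunction_one_eq, ← hϖ, div_eq_iff (Complex.ofReal_ne_zero.mpr hΩpos.ne')]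
    push_cast
    ring
  have hteq : t = ϖ * ratPlusSymbol f 0 := by exact_mod_cast ht.symm.trans ht'
  have hs0 : ratPlusSymbol f 0 ≠ 0 := by
    intro h0
    rw [h0, padicValRat.zero] at hs
    exact absurd hs (by norm_num)
  have hϖ0 : ϖ ≠ 0 := by
    intro h0
    apply hL
    rw [hf.entireLFunction_one_eq, ← hϖ, h0]
    push_cast
    ring
  rw [hteq, padicValRat.mul hϖ0 hs0]
  linarith

end Summit.BirchSwinnertonDyer.BirchSwinnertonDyer.Cruxes.SupersingularRankZeroAtTwo.R90c
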